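import Summits.NavierStokesRegularity.FluidComputer.RowEncloseRef
import Summits.NavierStokesRegularity.FluidComputer.RowPhaseSound
import HarnessLib

/-!
# `RowSection`: the decidable BOX-FORM SECTION READ-OUT of the scale induction step and its soundness
# (`pub-fluidc-bp3/R1-DESIGN.md` §12; kernel twin `code/thgate/g23/section23.py`)

HONEST FRAMING (cell `pub-fluidc`, blueprint seat bp3, gen 23): low prior, high value-of-information
experiment on Tao's machine paradigm; NOT a claim that NS blows up. Bookkeeping only, no fluid mechanics.

WHAT. The scale induction `I(n) ⇒ I(n+1)` of the toy chain reads the member OUT at ITS OWN crossing of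
the downstream section `π(v) := v_{b₂} − ρ v_{a₂} = 0` inside the last two rows of the certified chain
(the backward window row `rB`, ending at the reference crossing, and the forward `TPAST` row `rF`), and
asks that the level-normalised ratios `bmid · v_i / v_{b₂}` (`i = c₂, d₂, e₂`; at the crossing
`bmid · v_i / v_{b₂} = amid · v_i / v_{a₂}`, `bmid = ρ · amid`) land in the induction box
`ctr ± wid` and the level `v_{b₂} / bmid` in `[levLo, levHi]`. On a window row the member is
`v(t) = x̂(u) + e`, `u = t − T_row ∈ [0, H]`, `|e_a| ≤ Ē_a`, `e_{b₂} = 0` (`b₂` is the lock coordinate: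
`Ē_{b₂} = 0`), so `π(v(t)) = π̂(u) − ρ e_{a₂}`. The Boolean `sectionOK rB rF c` checks, in the rows'
`P`-scaled outward-rounded intervals (`DIVec`, `XIon` = interval Horner of the reference):
(S1) `π̂_B(0) + ρ Ē_{B,a₂} < 0`; (S2) `π̂_F(H_F) − ρ Ē_{F,a₂} > 0` — a crossing exists (IVT);
(S3) for each of `M` sub-intervals `V_m` of each window row (`subI`), with `X := XIon V_m`: EITHER the
piece is excluded (`π̂ > ρ Ē_{a₂}` or `π̂ < −ρ Ē_{a₂}` on it: no member crosses there) OR `X_{b₂} > 0`,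
`[levLo, levHi] ⊇ X_{b₂} / bmid` and `ctr_j ± wid_j ⊇ bmid (X_i + [−Ē_i, Ē_i]) / X_{b₂}`.
**`section_sound`**: `sectionOK = true` + the two rows' tubes + continuity of the member in phase
time ⇒ a crossing instant exists in the window with the read-out in the box and the level in range.
Nothing here refers to a particular chain; the instantiation on the chain of record is `RowCircuitSection`.

[cite: Tao2016AveragedNS, §5.5 Thm 5.3 (5.5)]
-/

namespace Summit.NavierStokesRegularity.FluidComputer

open Literature.Analysis.FluidPDE.FluidComputer

namespace RowCheck

open DIVec ChainField Set

/-- The induction-box certificate: section slope `ρ`, level unit `bmid` (`= ρ · amid`), the box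
`ctr ± wid` of the three read-out ratios (`c₂, d₂, e₂` over the carrier), the level range and the number
of sub-intervals per window row. [folklore] -/
structure SecCert where
  /-- section slope `ρ = X0_{b₁} / X0_{a₁}` -/
  rho : ℚ
  /-- level unit `bmid = X0_{b₁}` -/
  bmid : ℚ
  /-- box centres (`c, d, z`) -/
  ctr : Fin 3 → ℚ
  /-- box half-widths -/
  wid : Fin 3 → ℚ
  /-- level range, lower end -/
  levLo : ℚ
  /-- level range, upper end -/
  levHi : ℚ
  /-- sub-intervals per window row -/
  M : ℕ

/-- Read-out coordinate `j ↦` state index: `c₂ = 6`, `d₂ = 7`, `e₂ = 8`. [folklore] -/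
def rdIdx (j : Fin 3) : Fin 9 := ⟨j.val + 6, by omega⟩

/-- The symmetric interval `[−e, e]` (scaled). [folklore] -/
def symI (e : ℤ) : DI := ⟨-e, e⟩

/-- [folklore] -/
theorem mem_symI {P : ℕ} {e : ℤ} {x : ℝ} (hx : |x| ≤ (e : ℝ) / 2 ^ P) : (symI e).mem P x := by
  have h2 : (0 : ℝ) < 2 ^ P := by positivity
  have h1 : |x * 2 ^ P| ≤ (e : ℝ) := by
    rw [abs_mul, abs_of_pos h2]; rwa [le_div_iff₀ h2] at hx
  obtain ⟨ha, hb⟩ := abs_le.mp h1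
  refine ⟨?_, ?_⟩ <;> simp only [symI, Int.cast_neg] <;> linarith

/-- `hi < 0` forces the enclosed real negative. [folklore] -/
theorem neg_of_hi_neg {P : ℕ} {I : DI} {x : ℝ} (h : I.hi < 0) (hx : I.mem P x) : x < 0 := by
  have h2 : (0 : ℝ) < 2 ^ P := by positivity
  have hh : (I.hi : ℝ) < 0 := by exact_mod_cast h
  nlinarith [hx.2]

/-- `0 < lo` forces the enclosed real positive. [folklore] -/
theorem pos_of_lo_pos {P : ℕ} {I : DI} {x : ℝ} (h : 0 < I.lo) (hx : I.mem P x) : 0 < x := by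
  have h2 : (0 : ℝ) < 2 ^ P := by positivity
  have hh : (0 : ℝ) < I.lo := by exact_mod_cast h
  nlinarith [hx.1]

/-- A rational below an interval: `(ofFrac q).hi ≤ J.lo`. [folklore] -/
theorem rat_le_of_hi_le {P : ℕ} {q : ℚ} {J : DI} {y : ℝ} (h : (ofFrac P q).hi ≤ J.lo)
    (hy : J.mem P y) : (q : ℝ) ≤ y := by
  have h2 : (0 : ℝ) < 2 ^ P := by positivity
  have hq := (mem_ofFrac P q).2
  have hh : ((ofFrac P q).hi : ℝ) ≤ J.lo := by exact_mod_cast h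
  nlinarith [hy.1]

/-- A rational above an interval: `J.hi ≤ (ofFrac q).lo`. [folklore] -/
theorem le_rat_of_hi_le {P : ℕ} {q : ℚ} {J : DI} {y : ℝ} (h : J.hi ≤ (ofFrac P q).lo)
    (hy : J.mem P y) : y ≤ (q : ℝ) := by
  have h2 : (0 : ℝ) < 2 ^ P := by positivity
  have hq := (mem_ofFrac P q).1
  have hh : (J.hi : ℝ) ≤ (ofFrac P q).lo := by exact_mod_cast h
  nlinarith [hy.2]

/-- Separated intervals: `I.hi < J.lo` forces `x < y`. [folklore] -/
theorem lt_of_hi_lt_lo {P : ℕ} {I J : DI} {x y : ℝ} (h : I.hi < J.lo) (hx : I.mem P x)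
    (hy : J.mem P y) : x < y := by
  have h2 : (0 : ℝ) < 2 ^ P := by positivity
  have hh : (I.hi : ℝ) < J.lo := by exact_mod_cast h
  nlinarith [hx.2, hy.1]

namespace RowData

variable (r : RowData) (c : SecCert)

/-- `ρ` as an interval. [folklore] -/
def rhoI : DI := ofFrac r.P c.rho

/-- `bmid` as an interval. [folklore] -/
def bmidI : DI := ofFrac r.P c.bmid

/-- `π̂ = x̂_{b₂} − ρ x̂_{a₂}` over a reference enclosure `X`. [folklore] -/
def piOf (X : Vec DI 9) : DI := (X.get 5).sub ((r.rhoI c).mul r.P (X.get 4))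

/-- `ρ Ē_{a₂}` as an interval. [folklore] -/
def rhoE : DI := (r.rhoI c).mul r.P (DI.pt (r.Eb 4))

/-- The read-out ratio `bmid (X_i + [−Ē_i, Ē_i]) / X_{b₂}` over a reference enclosure. [folklore] -/
def ratioOf (X : Vec DI 9) (j : Fin 3) : DI :=
  ((r.bmidI c).mul r.P ((X.get (rdIdx j)).add (symI (r.Eb (rdIdx j))))).div r.P (X.get 5)

/-- (S1) on the backward window row: `π̂(0) + ρ Ē_{a₂} < 0`, and `b₂` is the lock (`Ē_{b₂} = 0`). [folklore] -/
def secStartOK : Bool :=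
  decide (((r.piOf c (r.XIon (DI.pt 0))).add (r.rhoE c)).hi < 0) && decide (r.Eb 5 = 0)

/-- (S2) on the forward window row: `π̂(H) − ρ Ē_{a₂} > 0`, and `Ē_{b₂} = 0`. [folklore] -/
def secEndOK : Bool :=
  decide (0 < ((r.piOf c (r.XIon (ofFrac r.P r.Hq))).sub (r.rhoE c)).lo) && decide (r.Eb 5 = 0)

/-- (S3) on one sub-interval: excluded, or the read-out / level checks. [folklore] -/
def pieceOK (m : ℕ) : Bool :=
  let X := r.XIon (subI r.P r.Hq c.M m)
  let piX := r.piOf c X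
  let rE := r.rhoE c
  (decide (rE.hi < piX.lo) || decide (piX.hi < (rE.neg).lo)) ||
  (DI.posB (X.get 5) && DI.posB (r.bmidI c) &&
    decide ((ofFrac r.P c.levLo).hi ≤ ((X.get 5).div r.P (r.bmidI c)).lo) &&
    decide (((X.get 5).div r.P (r.bmidI c)).hi ≤ (ofFrac r.P c.levHi).lo) &&
    decide (∀ j : Fin 3, (ofFrac r.P (c.ctr j - c.wid j)).hi ≤ (r.ratioOf c X j).lo ∧
      (r.ratioOf c X j).hi ≤ (ofFrac r.P (c.ctr j + c.wid j)).lo))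

/-- All `M` pieces of a window row. [folklore] -/
def piecesOK : Bool := (List.range c.M).all fun m => r.pieceOK c m

end RowData

/-- **The section read-out certificate** of the window rows `rB | rF`. [folklore] -/
def sectionOK (rB rF : RowData) (c : SecCert) : Bool :=
  decide (0 < c.M) && decide (0 < c.rho) && decide (0 < rB.Hq) && decide (0 < rF.Hq) &&
    rB.secStartOK c && rF.secEndOK c && rB.piecesOK c && rF.piecesOK c

/-! ### Soundness -/

namespace RowData

variable {r : RowData} {c : SecCert}

/-- `ρ ∈ rhoI`. [folklore] -/
theorem mem_rhoI : (r.rhoI c).mem r.P (c.rho : ℝ) := mem_ofFrac _ _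

/-- `Ē_{a₂} ∈ pt (Eb 4)` in the form `EbarR`. [folklore] -/
theorem mem_Eb (a : Fin 9) : (DI.pt (r.Eb a)).mem r.P (r.EbarR a) := DI.mem_pt r.P (r.Eb a)

/-- `π̂ ∈ piOf X` when `X` encloses the reference. [folklore] -/
theorem mem_piOf {X : Vec DI 9} {x : Fin 9 → ℝ} (hX : ∀ i, (X.get i).mem r.P (x i)) :
    (r.piOf c X).mem r.P (x 5 - c.rho * x 4) :=
  DI.mem_sub (hX 5) (DI.mem_mul mem_rhoI (hX 4))

/-- `ρ Ē_{a₂} ∈ rhoE`. [folklore] -/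
theorem mem_rhoE : (r.rhoE c).mem r.P ((c.rho : ℝ) * r.EbarR 4) := DI.mem_mul mem_rhoI (mem_Eb 4)

/-- The lock coordinate of a window row is exact: `Ē_{b₂} = 0 ⇒ v_{b₂} = x̂_{b₂}`. [folklore] -/
theorem eq_of_Eb5 (h5 : r.Eb 5 = 0) {v : Fin 9 → ℝ} {u : ℝ}
    (hv : ∀ a, |v a - xh r.CQ u a| ≤ r.EbarR a) : v 5 = xh r.CQ u 5 := by
  have h := hv 5
  rw [show r.EbarR 5 = 0 by simp [EbarR, toR, h5]] at h
  have := abs_nonpos_iff.mp h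
  linarith

/-- **(S3) soundness on one piece**: at a crossing inside the piece the read-out lands in the box and
the level in range. [folklore] -/
theorem piece_sound {m : ℕ} (h : r.pieceOK c m = true) (hrho : 0 < c.rho) {u : ℝ}
    (hu : (subI r.P r.Hq c.M m).mem r.P u) {v : Fin 9 → ℝ}
    (hv : ∀ a, |v a - xh r.CQ u a| ≤ r.EbarR a) (h5 : v 5 = xh r.CQ u 5)
    (hsec : v 5 = c.rho * v 4) :
    0 < v 5 ∧ ((c.levLo : ℝ) ≤ v 5 / c.bmid ∧ v 5 / c.bmid ≤ c.levHi) ∧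
      ∀ j : Fin 3, |(c.bmid : ℝ) * v (rdIdx j) / v 5 - c.ctr j| ≤ c.wid j := by
  set X := r.XIon (subI r.P r.Hq c.M m) with hXdef
  have hX : ∀ i, (X.get i).mem r.P (xh r.CQ u i) := fun i => mem_XIon r hu i
  have hpi : (r.piOf c X).mem r.P (xh r.CQ u 5 - c.rho * xh r.CQ u 4) := mem_piOf hX
  have hrE : (r.rhoE c).mem r.P ((c.rho : ℝ) * r.EbarR 4) := mem_rhoE
  -- at the crossing `π̂(u) = ρ e_{a₂}`, `|e_{a₂}| ≤ Ē_{a₂}`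
  have hpival : xh r.CQ u 5 - c.rho * xh r.CQ u 4 = c.rho * (v 4 - xh r.CQ u 4) := by
    rw [← h5, hsec]; ring
  have hrho' : (0 : ℝ) < c.rho := by exact_mod_cast hrho
  have he4 := abs_le.mp (hv 4)
  have hub : xh r.CQ u 5 - c.rho * xh r.CQ u 4 ≤ c.rho * r.EbarR 4 := by
    rw [hpival]; exact mul_le_mul_of_nonneg_left he4.2 hrho'.le
  have hlb : -((c.rho : ℝ) * r.EbarR 4) ≤ xh r.CQ u 5 - c.rho * xh r.CQ u 4 := by
    rw [hpival]; nlinarith [he4.1]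
  simp only [pieceOK, Bool.or_eq_true, Bool.and_eq_true, decide_eq_true_eq] at h
  rw [← hXdef] at h
  rcases h with (hex | hex) | ⟨⟨⟨⟨hpos5, hposb⟩, hlevlo⟩, hlevhi⟩, hrat⟩
  · exact absurd (lt_of_hi_lt_lo hex hrE hpi) (not_lt.mpr hub)
  · have := lt_of_hi_lt_lo hex hpi (DI.mem_neg hrE)
    exact absurd this (not_lt.mpr hlb)
  have hv5 : 0 < v 5 := by rw [h5]; exact DI.pos_of_posB hpos5 (hX 5)
  have hbpos : 0 < (r.bmidI c).lo := by simpa [DI.posB] using hposb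
  have hbmid : (r.bmidI c).mem r.P (c.bmid : ℝ) := mem_ofFrac _ _
  have hlev : ((X.get 5).div r.P (r.bmidI c)).mem r.P (v 5 / c.bmid) := by
    rw [h5]; exact DI.mem_div hbpos (hX 5) hbmid
  refine ⟨hv5, ⟨rat_le_of_hi_le hlevlo hlev, le_rat_of_hi_le hlevhi hlev⟩, fun j => ?_⟩
  obtain ⟨hlo, hhi⟩ := hrat j
  have h5pos : 0 < (X.get 5).lo := by simpa [DI.posB] using hpos5
  have hnum : ((r.bmidI c).mul r.P ((X.get (rdIdx j)).add (symI (r.Eb (rdIdx j))))).mem r.P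
      ((c.bmid : ℝ) * v (rdIdx j)) := by
    have he : (symI (r.Eb (rdIdx j))).mem r.P (v (rdIdx j) - xh r.CQ u (rdIdx j)) :=
      mem_symI (by simpa [EbarR, toR] using hv (rdIdx j))
    have := DI.mem_mul hbmid (DI.mem_add (hX (rdIdx j)) he)
    simpa using this
  have hq : (r.ratioOf c X j).mem r.P ((c.bmid : ℝ) * v (rdIdx j) / v 5) := by
    rw [show (c.bmid : ℝ) * v (rdIdx j) / v 5 = (c.bmid : ℝ) * v (rdIdx j) / xh r.CQ u 5 by
      rw [h5]]
    exact DI.mem_div h5pos hnum (hX 5)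
  have h1 := rat_le_of_hi_le hlo hq
  have h2 := le_rat_of_hi_le hhi hq
  push_cast at h1 h2
  rw [abs_le]
  constructor <;> linarith

/-- **(S3) soundness on a window row**: a crossing at `u ∈ [0, H]` of the row reads out in the box. [folklore] -/
theorem pieces_sound (h : r.piecesOK c = true) (hM : 0 < c.M) (hH : 0 < r.Hq) (hrho : 0 < c.rho)
    (h5z : r.Eb 5 = 0) {u : ℝ} (hu : u ∈ Icc 0 (r.Hq : ℝ)) {v : Fin 9 → ℝ}
    (hv : ∀ a, |v a - xh r.CQ u a| ≤ r.EbarR a) (hsec : v 5 = c.rho * v 4) :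
    0 < v 5 ∧ ((c.levLo : ℝ) ≤ v 5 / c.bmid ∧ v 5 / c.bmid ≤ c.levHi) ∧
      ∀ j : Fin 3, |(c.bmid : ℝ) * v (rdIdx j) / v 5 - c.ctr j| ≤ c.wid j := by
  have hH' : (0 : ℝ) < r.Hq := by exact_mod_cast hH
  obtain ⟨m, hm, hmem⟩ := exists_mem_subI r.P hM r.Hq hH' hu
  have hpm : r.pieceOK c m = true := by
    simp only [piecesOK, List.all_eq_true, List.mem_range] at h
    exact h m hm
  exact piece_sound hpm hrho hmem hv (eq_of_Eb5 h5z hv) hsec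

/-- **(S1) soundness**: at the start of the backward row every member is below the section. [folklore] -/
theorem secStart_sound (h : r.secStartOK c = true) (hrho : 0 < c.rho) {v : Fin 9 → ℝ}
    (hv : ∀ a, |v a - xh r.CQ 0 a| ≤ r.EbarR a) : v 5 - c.rho * v 4 < 0 := by
  simp only [secStartOK, Bool.and_eq_true, decide_eq_true_eq] at h
  obtain ⟨hhi, h5z⟩ := h
  have h0 : (DI.pt 0).mem r.P (0 : ℝ) := by simpa using DI.mem_pt r.P 0
  have hX : ∀ i, ((r.XIon (DI.pt 0)).get i).mem r.P (xh r.CQ 0 i) := fun i => mem_XIon r h0 i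
  have hsum := DI.mem_add (mem_piOf (c := c) hX) (mem_rhoE (r := r) (c := c))
  have hneg := neg_of_hi_neg hhi hsum
  have h5 := eq_of_Eb5 h5z hv
  have hrho' : (0 : ℝ) < c.rho := by exact_mod_cast hrho
  have he4 := (abs_le.mp (hv 4)).1
  rw [h5]
  nlinarith

/-- **(S2) soundness**: at the end of the forward row every member is above the section. [folklore] -/
theorem secEnd_sound (h : r.secEndOK c = true) (hrho : 0 < c.rho) {v : Fin 9 → ℝ}
    (hv : ∀ a, |v a - xh r.CQ r.Hq a| ≤ r.EbarR a) : 0 < v 5 - c.rho * v 4 := by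
  simp only [secEndOK, Bool.and_eq_true, decide_eq_true_eq] at h
  obtain ⟨hlo, h5z⟩ := h
  have hHm : (ofFrac r.P r.Hq).mem r.P ((r.Hq : ℚ) : ℝ) := mem_ofFrac _ _
  have hX : ∀ i, ((r.XIon (ofFrac r.P r.Hq)).get i).mem r.P (xh r.CQ r.Hq i) := fun i =>
    mem_XIon r hHm i
  have hdiff := DI.mem_sub (mem_piOf (c := c) hX) (mem_rhoE (r := r) (c := c))
  have hpos := pos_of_lo_pos hlo hdiff
  have h5 := eq_of_Eb5 h5z hv
  have hrho' : (0 : ℝ) < c.rho := by exact_mod_cast hrho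
  have he4 := (abs_le.mp (hv 4)).2
  rw [h5]
  nlinarith

end RowData

/-- **Soundness of the section read-out certificate.** The member in phase time `v` (continuous on
each window row, inside the two rows' tubes) crosses the section `v_{b₂} = ρ v_{a₂}` at some instant
of the window `[TB, TE]`, and there the carrier is positive, the level `v_{b₂}/bmid` lies in
`[levLo, levHi]` and the three read-out ratios lie in the induction box `ctr ± wid`. [folklore] -/
theorem section_sound {rB rF : RowData} {c : SecCert} (h : sectionOK rB rF c = true)
    {v : ℝ → Fin 9 → ℝ} {TB TF TE : ℝ} (hTF : TF = TB + rB.Hq) (hTE : TE = TF + rF.Hq)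
    (hcB : ContinuousOn v (Icc TB TF)) (hcF : ContinuousOn v (Icc TF TE))
    (htB : ∀ t ∈ Icc TB TF, ∀ a, |v t a - xh rB.CQ (t - TB) a| ≤ rB.EbarR a)
    (htF : ∀ t ∈ Icc TF TE, ∀ a, |v t a - xh rF.CQ (t - TF) a| ≤ rF.EbarR a) :
    ∃ t ∈ Icc TB TE, v t 5 = c.rho * v t 4 ∧ 0 < v t 4 ∧
      ((c.levLo : ℝ) ≤ v t 5 / c.bmid ∧ v t 5 / c.bmid ≤ c.levHi) ∧
      ∀ j : Fin 3, |(c.bmid : ℝ) * v t (rdIdx j) / v t 5 - c.ctr j| ≤ c.wid j := by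
  simp only [sectionOK, Bool.and_eq_true, decide_eq_true_eq] at h
  obtain ⟨⟨⟨⟨⟨⟨⟨hM, hrho⟩, hHB⟩, hHF⟩, hS1⟩, hS2⟩, hPB⟩, hPF⟩ := h
  have hHB' : (0 : ℝ) < rB.Hq := by exact_mod_cast hHB
  have hHF' : (0 : ℝ) < rF.Hq := by exact_mod_cast hHF
  have hBF : TB ≤ TF := by rw [hTF]; linarith
  have hFE : TF ≤ TE := by rw [hTE]; linarith
  have hrho' : (0 : ℝ) < c.rho := by exact_mod_cast hrho
  have h5B : rB.Eb 5 = 0 := by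
    simp only [RowData.secStartOK, Bool.and_eq_true, decide_eq_true_eq] at hS1; exact hS1.2
  have h5F : rF.Eb 5 = 0 := by
    simp only [RowData.secEndOK, Bool.and_eq_true, decide_eq_true_eq] at hS2; exact hS2.2
  -- the section function in phase time
  set f : ℝ → ℝ := fun t => v t 5 - c.rho * v t 4 with hf
  have hfc : ∀ {a b : ℝ}, ContinuousOn v (Icc a b) → ContinuousOn f (Icc a b) := fun hc =>
    ((continuous_apply 5).comp_continuousOn hc).sub
      (((continuous_apply 4).comp_continuousOn hc).const_smul (c.rho : ℝ) |>.congr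
        (fun t _ => by simp [smul_eq_mul]))
  have hfB : f TB < 0 := by
    have := htB TB ⟨le_rfl, hBF⟩
    simp only [sub_self] at this
    exact RowData.secStart_sound hS1 hrho this
  have hfE : 0 < f TE := by
    have := htF TE ⟨hFE, le_rfl⟩
    rw [show TE - TF = rF.Hq by rw [hTE]; ring] at this
    exact RowData.secEnd_sound hS2 hrho this
  -- conclusion from a crossing inside one row
  have concl : ∀ (r : RowData) (T T' : ℝ), T' = T + r.Hq → 0 < r.Hq → r.piecesOK c = true →
      r.Eb 5 = 0 → (∀ t ∈ Icc T T', ∀ a, |v t a - xh r.CQ (t - T) a| ≤ r.EbarR a) →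
      ∀ t ∈ Icc T T', f t = 0 → Icc T T' ⊆ Icc TB TE →
      ∃ t ∈ Icc TB TE, v t 5 = c.rho * v t 4 ∧ 0 < v t 4 ∧
        ((c.levLo : ℝ) ≤ v t 5 / c.bmid ∧ v t 5 / c.bmid ≤ c.levHi) ∧
        ∀ j : Fin 3, |(c.bmid : ℝ) * v t (rdIdx j) / v t 5 - c.ctr j| ≤ c.wid j := by
    intro r T T' hT' hH hP h5z ht t htI hft hsub
    have hsec : v t 5 = c.rho * v t 4 := by
      have : f t = v t 5 - c.rho * v t 4 := rfl
      linarith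
    have hu : t - T ∈ Icc 0 (r.Hq : ℝ) := ⟨by linarith [htI.1], by rw [hT'] at htI; linarith [htI.2]⟩
    obtain ⟨hv5, hlev, hrat⟩ := RowData.pieces_sound hP hM hH hrho h5z hu (ht t htI) hsec
    refine ⟨t, hsub htI, hsec, ?_, hlev, hrat⟩
    have hrho'' : (0 : ℝ) < c.rho := hrho'
    nlinarith
  by_cases hmid : 0 ≤ f TF
  · -- crossing in the backward row
    obtain ⟨t, htI, hft⟩ : ∃ t ∈ Icc TB TF, f t = 0 := by
      have hivt := intermediate_value_Icc hBF (hfc hcB)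
      exact hivt ⟨hfB.le, hmid⟩
    exact concl rB TB TF hTF hHB hPB h5B htB t htI hft (Icc_subset_Icc le_rfl hFE)
  · -- crossing in the forward row
    push Not at hmid
    obtain ⟨t, htI, hft⟩ : ∃ t ∈ Icc TF TE, f t = 0 := by
      have hivt := intermediate_value_Icc hFE (hfc hcF)
      exact hivt ⟨hmid.le, hfE.le⟩
    exact concl rF TF TE hTE hHF hPF h5F htF t htI hft (Icc_subset_Icc hBF le_rfl)

end RowCheck

end Summit.NavierStokesRegularity.FluidComputer
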